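import Summits.Ventures.Crystal3D.Statement
import Summits.Ventures.Crystal3D.StickySpheres.SmallContactInduction
import Summits.Ventures.Crystal3D.StickySpheres.PlanarDiscs
import Summits.Ventures.Crystal3D.StickySpheres.PlanarSearch
import HarnessLib

/-!
# The planar control case, formally: `c(2..7) = 1, 3, 5, 7, 9, 12` and `HarborthUpTo 7`

Venture `Crystal3D` (cell `pub-crystal3d`, seat p2). The cell's two-dimensional STEP-0 (Harborth / Heitmann–Radin:
the maximal number of contacts of `N` unit discs is `⌊3N − √(12N − 3)⌋`) re-derived INSIDE THE KERNEL for `N ≤ 7`, by the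
same architecture as the three-dimensional `C(7) = 15` (`ContactSeven.lean`): graph filters that are theorems
(`PlanarDiscs.lean`: `K₄` and `K_{2,3}` are not penny graphs, nor is the wheel `W₅`), a kernel-checked search over the
missing edge slots (`PlanarSearch.lean`), vertex removal (`c(7) ≤ 12` from `c(6) ≤ 9`: a disc of minimal degree has
`7·deg ≤ 2·C`), and explicit witnesses in the triangular lattice `A₂` (`Theil2006.triPoint`, exact integer norm form
`m² + mn + n²`).

PROVED: `maxContacts 2 N = 1, 3, 5, 7, 9, 12` for `N = 2, …, 7`; `harborthNumber N` has the same values; hence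
`harborthUpTo_seven : HarborthUpTo 7` (the instance `N₀ = 7` of the Statement's STEP-0 target, with NO appeal to the
Literature fact `Harborth1974_contactNumber`). For `N = 4, 5` the bound holds for arbitrary configurations (unit-distance
graphs), for `N = 6, 7` the non-overlap is used. HONEST FRAMING: `N ≥ 8` is not touched (the planar census is the cell's
exact DP, not Lean); nothing about crystallization.
-/

noncomputable section

open Finset
open scoped BigOperators

namespace Summit.Ventures.Crystal3D

open SlotSearch
open Literature.Geometry.DiscreteGeometry (harborthNumber harborthNumber_seven)
open Literature.MathematicalPhysics.StatisticalMechanics (Theil2006.triPoint Theil2006.norm_triPoint_sq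
  Theil2006.dist_triPoint Theil2006.one_le_norm_triPoint)

/-! ### 1. Missing edge slots of a configuration -/

/-- For any configuration `x` of `n` points: the slots of the NON-touching pairs form a set `S` with
`|S| + C(x) ≤ #pairs`, every member of `S` is the slot of a genuine pair, and every pair whose slot is not in `S` touches.
[folklore] -/
theorem exists_missing_slots {d n : ℕ} (x : Fin n → EuclideanSpace ℝ (Fin d)) :
    ∃ S : Finset ℕ, S.card + numContacts x ≤ (univ.filter fun p : Fin n × Fin n => p.1 < p.2).card ∧
      (∀ i ∈ S, ∃ a b : Fin n, a ≠ b ∧ pidxN a b = i) ∧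
      (∀ a b : Fin n, a ≠ b → pidxN a b ∉ S → dist (x a) (x b) = 1) := by
  classical
  obtain ⟨NC, hNC⟩ : ∃ NC : Finset (Fin n × Fin n),
      NC = univ.filter fun p : Fin n × Fin n => p.1 < p.2 ∧ dist (x p.1) (x p.2) ≠ 1 := ⟨_, rfl⟩
  refine ⟨NC.image fun p => pidxN p.1 p.2, ?_, ?_, ?_⟩
  · have hunion : contactPairs x ∪ NC = univ.filter fun p : Fin n × Fin n => p.1 < p.2 := by
      ext p
      simp only [mem_union, mem_contactPairs, hNC, mem_filter, mem_univ, true_and]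
      tauto
    have hdisj : Disjoint (contactPairs x) NC := by
      rw [Finset.disjoint_left]
      intro p hp hq
      rw [mem_contactPairs] at hp
      rw [hNC, mem_filter] at hq
      exact hq.2.2 hp.2
    have h := card_union_of_disjoint hdisj
    rw [hunion] at h
    have h2 : (NC.image fun p => pidxN p.1 p.2).card ≤ NC.card := card_image_le
    unfold numContacts
    omega
  · intro i hi
    obtain ⟨p, hp, rfl⟩ := mem_image.1 hi
    rw [hNC, mem_filter] at hp
    exact ⟨p.1, p.2, ne_of_lt hp.2.1, rfl⟩
  · intro a b hab hS
    by_contra hd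
    apply hS
    rcases lt_or_gt_of_ne hab with hlt | hlt
    · have hmem : (a, b) ∈ NC := by
        rw [hNC, mem_filter]
        exact ⟨mem_univ _, hlt, hd⟩
      exact mem_image.2 ⟨(a, b), hmem, rfl⟩
    · have hmem : (b, a) ∈ NC := by
        rw [hNC, mem_filter]
        exact ⟨mem_univ _, hlt, fun h => hd (by rw [dist_comm]; exact h)⟩
      exact mem_image.2 ⟨(b, a), hmem, pidxN_comm b a⟩

/-- Numbers of pairs `i < j`. [folklore] -/
theorem card_ltPairs_small :
    (univ.filter fun p : Fin 2 × Fin 2 => p.1 < p.2).card = 1 ∧ (univ.filter fun p : Fin 3 × Fin 3 => p.1 < p.2).card = 3 ∧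
    (univ.filter fun p : Fin 4 × Fin 4 => p.1 < p.2).card = 6 ∧ (univ.filter fun p : Fin 5 × Fin 5 => p.1 < p.2).card = 10 ∧
    (univ.filter fun p : Fin 6 × Fin 6 => p.1 < p.2).card = 15 := by
  refine ⟨by decide, by decide, by decide, by decide, by decide⟩

/-! ### 2. Upper bounds for `N ≤ 7` discs -/

/-- Two points: at most one contact. [folklore] -/
theorem numContacts_le_one_of_two {d : ℕ} (x : Fin 2 → EuclideanSpace ℝ (Fin d)) : numContacts x ≤ 1 := by
  obtain ⟨S, hS, -, -⟩ := exists_missing_slots x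
  rw [card_ltPairs_small.1] at hS
  omega

/-- Three points: at most three contacts. [folklore] -/
theorem numContacts_le_three_of_three {d : ℕ} (x : Fin 3 → EuclideanSpace ℝ (Fin d)) : numContacts x ≤ 3 := by
  obtain ⟨S, hS, -, -⟩ := exists_missing_slots x
  rw [card_ltPairs_small.2.1] at hS
  omega

/-- **Four points of the plane have at most five pairs at distance `1`** (`K₄` is not a unit-distance graph). [folklore] -/
theorem numContacts_le_five_of_four (x : Fin 4 → EuclideanSpace ℝ (Fin 2)) : numContacts x ≤ 5 := by
  by_contra h
  obtain ⟨S, hS, -, hcon⟩ := exists_missing_slots x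
  rw [card_ltPairs_small.2.2.1] at hS
  have hS0 : S = ∅ := Finset.card_eq_zero.1 (by omega)
  have hc : ∀ a b : Fin 4, a ≠ b → dist (x a) (x b) = 1 := fun a b hab => hcon a b hab (by simp [hS0])
  exact no_four_pairwise_dist_one_plane (hc 0 1 (by decide)) (hc 0 2 (by decide)) (hc 0 3 (by decide))
    (hc 1 2 (by decide)) (hc 1 3 (by decide)) (hc 2 3 (by decide))

/-- **Five discs have at most seven contacts**: with eight, the search gives a `K₄` or a `K_{2,3}` among the touching
pairs, neither of which exists in the plane. (Distinct centres are needed: a doubled point on a rhombus has eight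
unit-distance index pairs.) [folklore] -/
theorem numContacts_le_seven_of_five {x : Fin 5 → EuclideanSpace ℝ (Fin 2)} (hx : IsUnitPacking x) :
    numContacts x ≤ 7 := by
  by_contra h
  obtain ⟨S, hS, hSlt, hcon⟩ := exists_missing_slots x
  rw [card_ltPairs_small.2.2.2.1] at hS
  have hS10 : ∀ i ∈ S, i < 10 := by
    intro i hi
    obtain ⟨a, b, hab, rfl⟩ := hSlt i hi
    exact pidxN_lt_five a b hab
  rcases exists_pattern5 S hS10 (by omega) with ⟨t, ht, hfree⟩ | ⟨t, ht, hfree⟩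
  · have hv := k4Tuples5_valid t ht
    obtain ⟨a, b, c, e⟩ := t
    have H : ∀ ed ∈ k4Edges (a, b, c, e), dist (x ed.1) (x ed.2) = 1 :=
      fun ed hed => hcon _ _ (hv ed hed) (hfree ed hed)
    simp only [k4Edges, List.forall_mem_cons, List.not_mem_nil, false_implies, implies_true, and_true] at H
    obtain ⟨hab, hac, hae, hbc, hbe, hce⟩ := H
    exact no_four_pairwise_dist_one_plane hab hac hae hbc hbe hce
  · have hv := k23Tuples5_valid t ht
    obtain ⟨a, b, c, e, f⟩ := t
    obtain ⟨hv1, nab, nce, ncf, nef⟩ := hv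
    have H : ∀ ed ∈ k23Edges (a, b, c, e, f), dist (x ed.1) (x ed.2) = 1 :=
      fun ed hed => hcon _ _ (hv1 ed hed) (hfree ed hed)
    simp only [k23Edges, List.forall_mem_cons, List.not_mem_nil, false_implies, implies_true, and_true] at H
    obtain ⟨hac, hae, haf, hbc, hbe, hbf⟩ := H
    rw [dist_comm] at hac hae haf hbc hbe hbf
    exact common_neighbours_le_two_plane (hx.injective.ne nab) (hx.injective.ne nce) (hx.injective.ne ncf)
      (hx.injective.ne nef) hac hbc hae hbe haf hbf

/-- `no_planar_five_ring` with the ten contacts listed pair by pair (orientation of `SlotSearch.wheelEdges`). [folklore] -/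
theorem no_planar_five_ring' {O A B C D E : EuclideanSpace ℝ (Fin 2)} (hOA : dist O A = 1) (hOB : dist O B = 1)
    (hOC : dist O C = 1) (hOD : dist O D = 1) (hOE : dist O E = 1) (hAB : dist A B = 1) (hBC : dist B C = 1)
    (hCD : dist C D = 1) (hDE : dist D E = 1) (hEA : dist E A = 1) (hBD : 1 ≤ dist B D) (hAD : 1 ≤ dist A D) :
    False := by
  rw [dist_comm] at hOA hOB hOC hOD hOE
  refine no_planar_five_ring O ![A, B, C, D, E] ?_ hAB hBC hCD hDE hEA hBD hAD
  intro i
  fin_cases i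
  · exact hOA
  · exact hOB
  · exact hOC
  · exact hOD
  · exact hOE

/-- **Six discs have at most nine contacts**: with ten, the search gives a `K₄`, a `K_{2,3}` or a wheel `W₅` among the
touching pairs; the wheel is excluded by `no_planar_five_ring` (five times `60°` is not a full turn). [folklore] -/
theorem numContacts_le_nine_of_six {x : Fin 6 → EuclideanSpace ℝ (Fin 2)} (hx : IsUnitPacking x) :
    numContacts x ≤ 9 := by
  by_contra h
  obtain ⟨S, hS, hSlt, hcon⟩ := exists_missing_slots x
  rw [card_ltPairs_small.2.2.2.2] at hS
  have hS15 : ∀ i ∈ S, i < 15 := by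
    intro i hi
    obtain ⟨a, b, hab, rfl⟩ := hSlt i hi
    exact pidxN_lt_six a b hab
  rcases exists_pattern6 S hS15 (by omega) with ⟨t, ht, hfree⟩ | ⟨t, ht, hfree⟩ | ⟨t, ht, hfree⟩
  · have hv := k4Tuples6_valid t ht
    obtain ⟨a, b, c, e⟩ := t
    have H : ∀ ed ∈ k4Edges (a, b, c, e), dist (x ed.1) (x ed.2) = 1 :=
      fun ed hed => hcon _ _ (hv ed hed) (hfree ed hed)
    simp only [k4Edges, List.forall_mem_cons, List.not_mem_nil, false_implies, implies_true, and_true] at H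
    obtain ⟨hab, hac, hae, hbc, hbe, hce⟩ := H
    exact no_four_pairwise_dist_one_plane hab hac hae hbc hbe hce
  · have hv := k23Tuples6_valid t ht
    obtain ⟨a, b, c, e, f⟩ := t
    obtain ⟨hv1, nab, nce, ncf, nef⟩ := hv
    have H : ∀ ed ∈ k23Edges (a, b, c, e, f), dist (x ed.1) (x ed.2) = 1 :=
      fun ed hed => hcon _ _ (hv1 ed hed) (hfree ed hed)
    simp only [k23Edges, List.forall_mem_cons, List.not_mem_nil, false_implies, implies_true, and_true] at H
    obtain ⟨hac, hae, haf, hbc, hbe, hbf⟩ := H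
    rw [dist_comm] at hac hae haf hbc hbe hbf
    exact common_neighbours_le_two_plane (hx.injective.ne nab) (hx.injective.ne nce) (hx.injective.ne ncf)
      (hx.injective.ne nef) hac hbc hae hbe haf hbf
  · have hv := wheelTuples6_valid t ht
    obtain ⟨o, a, b, c, e, f⟩ := t
    obtain ⟨hv1, nbe, nae⟩ := hv
    have H : ∀ ed ∈ wheelEdges (o, a, b, c, e, f), dist (x ed.1) (x ed.2) = 1 :=
      fun ed hed => hcon _ _ (hv1 ed hed) (hfree ed hed)
    simp only [wheelEdges, List.forall_mem_cons, List.not_mem_nil, false_implies, implies_true, and_true] at H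
    obtain ⟨hoa, hob, hoc, hoe, hof, hab, hbc, hce, hef, hfa⟩ := H
    exact no_planar_five_ring' hoa hob hoc hoe hof hab hbc hce hef hfa (hx.one_le_dist nbe) (hx.one_le_dist nae)

/-- **Seven discs have at most twelve contacts**: a disc of minimal degree has `7·deg ≤ 2·C`; removing it leaves six discs
with at most nine contacts, so `7C ≤ 2C + 63`. [folklore] -/
theorem numContacts_le_twelve_of_seven {x : Fin 7 → EuclideanSpace ℝ (Fin 2)} (hx : IsUnitPacking x) :
    numContacts x ≤ 12 := by
  obtain ⟨i, -, hi⟩ : ∃ i ∈ (univ : Finset (Fin 7)), 7 * coordination x i ≤ 2 * numContacts x := by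
    refine Finset.exists_le_of_sum_le univ_nonempty ?_
    rw [← Finset.mul_sum, sum_coordination_eq x, Finset.sum_const, Finset.card_univ, Fintype.card_fin]
    simp
  have h1 := numContacts_eq_coordination_add x i
  have h2 := numContacts_le_nine_of_six (hx.succAbove i)
  omega

/-! ### 3. Witnesses in the triangular lattice `A₂` -/

/-- The norm form `m² + mn + n²` of `A₂` (squared length of `triPoint (m, n)`). [folklore] -/
def latNorm (k : ℤ × ℤ) : ℤ := k.1 ^ 2 + k.1 * k.2 + k.2 ^ 2

/-- Contact count of a lattice model: label pairs `i < j` whose difference has norm form `1`. [folklore] -/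
def latContacts {N : ℕ} (c : Fin N → ℤ × ℤ) : ℕ :=
  (univ.filter fun p : Fin N × Fin N => p.1 < p.2 ∧ latNorm (c p.1 - c p.2) = 1).card

/-- Two lattice points touch iff their difference has norm form `1`. [folklore] -/
theorem dist_triPoint_eq_one_iff (a b : ℤ × ℤ) :
    dist (Theil2006.triPoint a) (Theil2006.triPoint b) = 1 ↔ latNorm (a - b) = 1 := by
  rw [Theil2006.dist_triPoint]
  have hsq := Theil2006.norm_triPoint_sq (a - b)
  constructor
  · intro h
    rw [h, one_pow] at hsq
    unfold latNorm
    exact_mod_cast hsq.symm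
  · intro h
    unfold latNorm at h
    rw [h, Int.cast_one] at hsq
    exact (pow_eq_one_iff_of_nonneg (norm_nonneg _) two_ne_zero).1 hsq

/-- The contact number of a lattice model is its lattice contact count. [folklore] -/
theorem numContacts_triPoint {N : ℕ} (c : Fin N → ℤ × ℤ) :
    numContacts (fun i => Theil2006.triPoint (c i)) = latContacts c := by
  unfold numContacts contactPairs latContacts
  congr 1
  ext p
  simp only [mem_filter, mem_univ, true_and, dist_triPoint_eq_one_iff]

/-- An injective lattice model is a unit packing (non-zero lattice vectors have length `≥ 1`). [folklore] -/
theorem isUnitPacking_triPoint {N : ℕ} {c : Fin N → ℤ × ℤ} (hc : Function.Injective c) :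
    IsUnitPacking (fun i => Theil2006.triPoint (c i)) := by
  intro i j hij
  show 1 ≤ dist (Theil2006.triPoint (c i)) (Theil2006.triPoint (c j))
  rw [Theil2006.dist_triPoint]
  exact Theil2006.one_le_norm_triPoint (sub_ne_zero.2 (hc.ne hij))

/-- Lattice witnesses give lower bounds for `C(N)` in the plane. [folklore] -/
theorem le_maxContacts_two_of_lat {N k : ℕ} (c : Fin N → ℤ × ℤ) (hc : Function.Injective c)
    (hk : latContacts c = k) : k ≤ maxContacts 2 N :=
  le_maxContacts_of_witness (isUnitPacking_triPoint hc) ((numContacts_triPoint c).trans hk)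

/-- The hexagon `H₁`: the origin followed by its six lattice neighbours in cyclic order. [folklore] -/
def hexList : Fin 7 → ℤ × ℤ := ![(0, 0), (1, 0), (0, 1), (-1, 1), (-1, 0), (0, -1), (1, -1)]

/-- The first `N` points of the hexagon (`N ≤ 7`). [folklore] -/
def hexPrefix (N : ℕ) (h : N ≤ 7) : Fin N → ℤ × ℤ := fun i => hexList (Fin.castLE h i)

/-- The prefixes are injective and have `1, 3, 5, 7, 9, 12` contacts for `N = 2, …, 7`. [folklore] -/
theorem hexPrefix_data :
    (Function.Injective (hexPrefix 2 (by norm_num)) ∧ latContacts (hexPrefix 2 (by norm_num)) = 1) ∧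
    (Function.Injective (hexPrefix 3 (by norm_num)) ∧ latContacts (hexPrefix 3 (by norm_num)) = 3) ∧
    (Function.Injective (hexPrefix 4 (by norm_num)) ∧ latContacts (hexPrefix 4 (by norm_num)) = 5) ∧
    (Function.Injective (hexPrefix 5 (by norm_num)) ∧ latContacts (hexPrefix 5 (by norm_num)) = 7) ∧
    (Function.Injective (hexPrefix 6 (by norm_num)) ∧ latContacts (hexPrefix 6 (by norm_num)) = 9) ∧
    (Function.Injective (hexPrefix 7 (by norm_num)) ∧ latContacts (hexPrefix 7 (by norm_num)) = 12) := by
  refine ⟨⟨?_, ?_⟩, ⟨?_, ?_⟩, ⟨?_, ?_⟩, ⟨?_, ?_⟩, ⟨?_, ?_⟩, ⟨?_, ?_⟩⟩ <;> decide +kernel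

/-! ### 4. The values `c(2..7)` and `HarborthUpTo 7` -/

/-- **`c(2) = 1`.** [folklore] -/
theorem maxContacts_two_two : maxContacts 2 2 = 1 :=
  le_antisymm (maxContacts_le (by norm_num) fun x _ => numContacts_le_one_of_two x)
    (le_maxContacts_two_of_lat _ hexPrefix_data.1.1 hexPrefix_data.1.2)

/-- **`c(3) = 3`.** [folklore] -/
theorem maxContacts_two_three : maxContacts 2 3 = 3 :=
  le_antisymm (maxContacts_le (by norm_num) fun x _ => numContacts_le_three_of_three x)
    (le_maxContacts_two_of_lat _ hexPrefix_data.2.1.1 hexPrefix_data.2.1.2)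

/-- **`c(4) = 5`** (two triangles; `K₄` is impossible). [folklore] -/
theorem maxContacts_two_four : maxContacts 2 4 = 5 :=
  le_antisymm (maxContacts_le (by norm_num) fun x _ => numContacts_le_five_of_four x)
    (le_maxContacts_two_of_lat _ hexPrefix_data.2.2.1.1 hexPrefix_data.2.2.1.2)

/-- **`c(5) = 7`** (the trapezoid). [folklore] -/
theorem maxContacts_two_five : maxContacts 2 5 = 7 :=
  le_antisymm (maxContacts_le (by norm_num) fun _ hx => numContacts_le_seven_of_five hx)
    (le_maxContacts_two_of_lat _ hexPrefix_data.2.2.2.1.1 hexPrefix_data.2.2.2.1.2)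

/-- **`c(6) = 9`.** [folklore] -/
theorem maxContacts_two_six : maxContacts 2 6 = 9 :=
  le_antisymm (maxContacts_le (by norm_num) fun _ hx => numContacts_le_nine_of_six hx)
    (le_maxContacts_two_of_lat _ hexPrefix_data.2.2.2.2.1.1 hexPrefix_data.2.2.2.2.1.2)

/-- **`c(7) = 12`** (the hexagon `H₁`). [folklore] -/
theorem maxContacts_two_seven : maxContacts 2 7 = 12 :=
  le_antisymm (maxContacts_le (by norm_num) fun _ hx => numContacts_le_twelve_of_seven hx)
    (le_maxContacts_two_of_lat _ hexPrefix_data.2.2.2.2.2.1 hexPrefix_data.2.2.2.2.2.2)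

/-- Evaluating Harborth's number: `⌊3n − √(12n−3)⌋ = k` when `(3n−k−1)² < 12n−3 ≤ (3n−k)²`. [folklore] -/
theorem harborthNumber_eq_of_sq {n k : ℕ} (hk : (k : ℝ) + 1 ≤ 3 * n) (h1 : (12 * n - 3 : ℝ) ≤ (3 * n - k) ^ 2)
    (h2 : (3 * n - k - 1 : ℝ) ^ 2 < 12 * n - 3) : harborthNumber n = k := by
  rw [harborthNumber, Int.floor_eq_iff]
  have hs1 : Real.sqrt (12 * n - 3) ≤ 3 * n - k := by
    rw [show (3 * n - k : ℝ) = Real.sqrt ((3 * n - k) ^ 2) from (Real.sqrt_sq (by linarith)).symm]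
    exact Real.sqrt_le_sqrt h1
  have hs2 : (3 * n - k - 1 : ℝ) < Real.sqrt (12 * n - 3) := (Real.lt_sqrt (by linarith)).2 h2
  constructor
  · push_cast; linarith
  · push_cast; linarith

/-- Harborth's numbers for `N = 2, …, 6`: `1, 3, 5, 7, 9` (`N = 7`: `harborthNumber_seven`, tree). [folklore] -/
theorem harborthNumber_small : harborthNumber 2 = 1 ∧ harborthNumber 3 = 3 ∧ harborthNumber 4 = 5 ∧
    harborthNumber 5 = 7 ∧ harborthNumber 6 = 9 := by
  refine ⟨?_, ?_, ?_, ?_, ?_⟩ <;> exact harborthNumber_eq_of_sq (by norm_num) (by norm_num) (by norm_num)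

/-- **`HarborthUpTo 7`**: Harborth's formula `c(N) = ⌊3N − √(12N−3)⌋` for `2 ≤ N ≤ 7`, proved in the tree (the Statement's
STEP-0 target at `N₀ = 7`, without the Literature fact). [folklore] -/
theorem harborthUpTo_seven : HarborthUpTo 7 := by
  intro N h2 h7
  obtain ⟨e2, e3, e4, e5, e6⟩ := harborthNumber_small
  interval_cases N <;> simp only [HarborthFormula]
  · rw [maxContacts_two_two, e2]; norm_num
  · rw [maxContacts_two_three, e3]; norm_num
  · rw [maxContacts_two_four, e4]; norm_num
  · rw [maxContacts_two_five, e5]; norm_num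
  · rw [maxContacts_two_six, e6]; norm_num
  · rw [maxContacts_two_seven, harborthNumber_seven]; norm_num

end Summit.Ventures.Crystal3D

end
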